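import Literature.AlgebraicGeometry.HodgeTheory.HypersurfaceSectionComplementMorse
import Literature.AlgebraicGeometry.HodgeTheory.ComplexConjugationHolds
import HarnessLib

/-!
# The complement of a hyperplane is acyclic; the Hodge conjecture for hyperplanes `Y ≅ ℙⁿ ⊂ ℙⁿ⁺¹_ℂ`

Family `hodge`, layer `Literature/AlgebraicGeometry/HodgeTheory`. THEOREMS ONLY (no definition, no named
fact).

* `isZero_singularHomology_linComplSet` — **`{[v] | T v ≠ 0} ⊆ ℙ(E)` has no more HOMOLOGY than `ℙ(F)`**
  (homology twin of the tree's `subsingleton_singularCohomology_linComplSet`,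
  `HypersurfaceLefschetzProofs`): for a continuous linear `T : E → F` with a continuous section `S`, if
  `H_j(ℙ(F); M) = 0` then `H_j({T ≠ 0}; M) = 0` — the straight-line deformation `linHomotopy` and
  homotopy invariance of singular homology (Hatcher Thm. 2.10).
* `isZero_singularHomology_complexPointsCompl_hyperplane`,
  `isZero_singularHomology_compl_range_of_hyperplane` — **`H_j((ℙᴺ ∖ V₊(ℓ_a))(ℂ); M) = 0` for
  `j ≥ 1`** (`a ≠ 0`): the complement of a hyperplane retracts onto the point `ℙ(ℂ¹)`; also for the
  literal complement of the image of the complex points of a closed immersion `Y ↪ ℙᴺ_ℂ` onto `V₊(ℓ_a)`.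
* `linForm_coeff_eq_of_isHomogeneous_one` — a form of degree `1` is `Σⱼ coeff_{xⱼ}(F) · xⱼ`.
* `exists_surjective_map_of_isSmoothHypersurface_one` — **Lefschetz surjectivity in EVERY degree for a
  hyperplane**: for a smooth hypersurface `Y ⊂ ℙⁿ⁺¹_ℂ` of degree `1` and `p ≤ n`, the restriction
  `ι^* : H²ᵖ(ℙⁿ⁺¹(ℂ); ℂ) → H²ᵖ(Y(ℂ); ℂ)` is onto — the duality half of Voisin II Thm. 1.23 PROVED in the
  tree (`surjective_map_of_isZero_singularHomology_compl_range`, `HypersurfaceLefschetzFromVanishing`)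
  fed with the acyclicity of the complement (including the middle degree `2p = n`, which the
  Andreotti–Frankel range of `HypersurfaceComplementMorse` misses).
* `algebraicClasses_eq_top_of_isSmoothHypersurface_one` — hence every class on a hyperplane is
  algebraic (`algebraicClasses_eq_top_of_surjective_map`; `p > n` by `algebraicClasses_eq_top_of_lt`);
* **`hodgeConjectureFor_of_isSmoothHypersurface_one`** — the Hodge conjecture for every smooth
  hypersurface of degree `1` (`Y ≅ ℙⁿ`), in every dimension `n`, UNCONDITIONALLY (Hodge model:
  `nonempty_hodgeModel_holds`). Classically: `H²ᵖ(ℙⁿ, ℤ) = ℤ hᵖ` with `hᵖ` the class of a linear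
  subspace (Voisin I Thm. 7.14, §11.3); compare the tree's `hodgeConjectureFor_projectiveSpace` for the
  scheme `ℙᴺ_ℂ` itself.

Provenance: Literature home of the Summits-side
`Theorems/LimitExtensionHypersurfaceHodgeFourLowDegreeHyperplane` (route `LimitExtension`, item
`HypersurfaceHodgeFourLowDegree`, stmt-HodgeConjecture-3003; its `limitExtension_`-prefixed twins), which
`Literature/` may not import. Lane `lit-hodgefound`, seat p20.

## References

* [VoisinHodgeII2003] C. Voisin, Hodge Theory and Complex Algebraic Geometry II (CUP 2003), §1.2.2
  proof of Thm. 1.23 ((1.7)–(1.9)), §1.2.3 Cor. 1.24.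
* [VoisinHodgeI2002] C. Voisin, Hodge Theory and Complex Algebraic Geometry I (CUP 2002), Thm. 7.14,
  §11.1.2, §11.3.
* [HatcherAT2002] A. Hatcher, Algebraic Topology (CUP 2002), Prop. 2.8, Thm. 2.10, Cor. 2.11.
* [Hartshorne1977] R. Hartshorne, Algebraic Geometry, II Ex. 2.7 and Ex. 3.11(d).
* [Deligne2000] P. Deligne, The Hodge conjecture (Clay problem description), §1.
-/

noncomputable section

open scoped LinearAlgebra.Projectivization
open CategoryTheory CategoryTheory.Limits AlgebraicGeometry Topology
open Literature.AlgebraicTopology.SingularHomology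
open Literature.AlgebraicGeometry.HodgeTheory Literature.AlgebraicGeometry.Motives

namespace Literature.AlgebraicGeometry.HodgeTheory

/-! ### The complement of a projective linear subspace has no more homology than a complementary subspace -/

section LinCompl

variable {E F : Type} [AddCommGroup E] [Module ℂ E] [AddCommGroup F] [Module ℂ F]
  [TopologicalSpace E] [TopologicalSpace F] [IsTopologicalAddGroup E] [ContinuousSMul ℂ E]
  (T : E →L[ℂ] F) (S : F →L[ℂ] E)

/-- **`{[v] | T v ≠ 0} ⊆ ℙ(E)` has no more HOMOLOGY than `ℙ(F)`** (homology twin of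
`subsingleton_singularCohomology_linComplSet`): for a continuous linear `T : E → F` with a continuous
section `S`, if `H_j(ℙ(F); M) = 0` then `H_j({T ≠ 0}; M) = 0`, since by the straight-line deformation
`linHomotopy` and homotopy invariance of singular homology the identity of `H_j({T ≠ 0})` factors
through `H_j(ℙ(F)) = 0`. [cite: HatcherAT2002, Thm. 2.10 and Cor. 2.11] -/
theorem isZero_singularHomology_linComplSet {R M : Type} [CommRing R] [AddCommGroup M] [Module R M]
    (hTS : ∀ w, T (S w) = w) {j : ℕ} (h : IsZero (singularHomology R M (ℙ ℂ F) j)) :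
    IsZero (singularHomology R M (linComplSet (T : E →ₗ[ℂ] F)) j) := by
  rw [IsZero.iff_id_eq_zero, ← singularHomology.map_id R M (X := ↥(linComplSet (T : E →ₗ[ℂ] F))) j,
    ← singularHomology.map_eq_of_homotopic R M ⟨linHomotopy T S hTS⟩ j, singularHomology.map_comp,
    h.eq_of_tgt (singularHomology.map R M (linProj T) j) 0, zero_comp]

end LinCompl

/-! ### The complement of a hyperplane of `ℙᴺ_ℂ` is acyclic -/

section Hyperplane

variable {N : ℕ}

/-- **`H_j((ℙᴺ ∖ V₊(ℓ_a))(ℂ); M) = 0` for `j ≥ 1`**: the complex points of `ℙᴺ_ℂ` off the hyperplane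
`V₊(ℓ_a)` of a non-zero linear form `ℓ_a = Σ aⱼ xⱼ` are homeomorphic (`linComplHomeomorph`, Serre's
comparison) to `{[v] | ℓ_a(v) ≠ 0} ⊆ ℙ(ℂᴺ⁺¹)`, which retracts by deformation onto the point `ℙ(ℂ¹)`
(`linHomotopy` with a section of the row map of the single row `a`), whose homology vanishes in
positive degrees. [cite: HatcherAT2002, Prop. 2.8 and Thm. 2.10] -/
theorem isZero_singularHomology_complexPointsCompl_hyperplane {R M : Type} [CommRing R]
    [AddCommGroup M] [Module R M] {a : Fin (N + 1) → ℂ} (ha : a ≠ 0) {j : ℕ} (hj : j ≠ 0) :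
    IsZero (singularHomology R M
      (complexPointsCompl (projectiveSpace N ℂ) (linearSubspace N ![a])) j) := by
  have hA : LinearIndependent ℂ ![a] := linearIndependent_unique_iff.2 ha
  obtain ⟨g, hg⟩ := LinearMap.exists_rightInverse_of_surjective
    (linMapOfRows ![a] : (Fin (N + 1) → ℂ) →ₗ[ℂ] (Fin (0 + 1) → ℂ)) (range_linMapOfRows_eq_top hA)
  have hTS : ∀ w, linMapOfRows ![a] (LinearMap.toContinuousLinearMap g w) = w :=
    fun w ↦ LinearMap.congr_fun hg w
  haveI : Subsingleton (ℙ ℂ (Fin (0 + 1) → ℂ)) :=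
    HypersurfaceSectionComplement.subsingleton_projectivization_fin_one
  have h0 : IsZero (singularHomology R M (ℙ ℂ (Fin (0 + 1) → ℂ)) j) :=
    isZero_singularHomology_of_subsingleton R M hj
  exact (isZero_singularHomology_linComplSet (linMapOfRows ![a]) (LinearMap.toContinuousLinearMap g)
    hTS h0).of_iso (singularHomology.mapIso R M (linComplHomeomorph ![a]).symm j)

/-- **`H_j((ℙᴺ ∖ Y)(ℂ); M) = 0` for `j ≥ 1` when `Y ↪ ℙᴺ_ℂ` is a closed immersion onto a hyperplane
`V₊(ℓ_a)`, `a ≠ 0`** — stated for the literal complement of the image of the complex points, the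
hypothesis (AF) of `surjective_map_of_isZero_singularHomology_compl_range`: a complex point of `ℙᴺ_ℂ`
comes from `Y` iff its underlying point lies on `ι(Y) = V₊(ℓ_a)`
(`AlgPoints.mem_range_map_iff_pt_mem`), so this complement IS `(ℙᴺ ∖ V₊(ℓ_a))(ℂ)`.
[cite: HatcherAT2002, Prop. 2.8 and Thm. 2.10] [cite: Hartshorne1977, II Ex. 2.7 and Ex. 3.11(d)] -/
theorem isZero_singularHomology_compl_range_of_hyperplane {R M : Type} [CommRing R]
    [AddCommGroup M] [Module R M] {Y : SchemeOver ℂ} (ι : Y ⟶ projectiveSpace N ℂ)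
    [IsClosedImmersion ι.left] {a : Fin (N + 1) → ℂ} (ha : a ≠ 0)
    (hrange : letI := MvPolynomial.gradedAlgebra (σ := Fin (N + 1)) (R := ℂ)
      Set.range ι.left.base =
        ProjectiveSpectrum.zeroLocus (MvPolynomial.homogeneousSubmodule (Fin (N + 1)) ℂ) {linForm N a})
    {j : ℕ} (hj : j ≠ 0) :
    IsZero (singularHomology R M (↥(Set.range (AlgPoints.map (L := ℂ) ι))ᶜ) j) := by
  letI := MvPolynomial.gradedAlgebra (σ := Fin (N + 1)) (R := ℂ)
  have hlin : linearSubspace N ![a] =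
      ProjectiveSpectrum.zeroLocus (MvPolynomial.homogeneousSubmodule (Fin (N + 1)) ℂ) {linForm N a} := by
    unfold linearSubspace
    rw [Set.range_unique]
    rfl
  let e : ↥(Set.range (AlgPoints.map (L := ℂ) ι))ᶜ ≃ₜ
      complexPointsCompl (projectiveSpace N ℂ) (linearSubspace N ![a]) :=
    (Homeomorph.refl _).subtype fun P ↦ by
      rw [Homeomorph.refl_apply, Set.mem_compl_iff, AlgPoints.mem_range_map_iff_pt_mem, hlin, ← hrange]
      rfl
  exact (isZero_singularHomology_complexPointsCompl_hyperplane ha hj).of_iso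
    (singularHomology.mapIso R M e j)

/-- A linear form is `Σⱼ (coefficient of xⱼ) · xⱼ`: `ℓ_a = F` for `a = (coeff_{xⱼ} F)ⱼ` when `F` is
homogeneous of degree `1`. [cite: Hartshorne1977, I Ex. 5.9 and II.8.20.3] -/
theorem linForm_coeff_eq_of_isHomogeneous_one {F : MvPolynomial (Fin (N + 1)) ℂ}
    (hF : F.IsHomogeneous 1) :
    linForm N (fun j ↦ MvPolynomial.coeff (Finsupp.single j 1) F) = F := by
  classical
  ext d
  simp only [linForm, MvPolynomial.coeff_sum, MvPolynomial.coeff_C_mul, MvPolynomial.coeff_X, mul_ite,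
    mul_one, mul_zero]
  by_cases hd : ∃ p, Finsupp.single p 1 = d
  · obtain ⟨p, rfl⟩ := hd
    rw [Finset.sum_eq_single p (fun q _ hq ↦ if_neg fun h ↦
      hq (Finsupp.single_left_injective one_ne_zero h)) (fun h ↦ absurd (Finset.mem_univ p) h),
      if_pos rfl]
  · rw [Finset.sum_eq_zero fun p _ ↦ if_neg fun h ↦ hd ⟨p, h⟩]
    refine (hF.coeff_eq_zero fun hdeg ↦ hd ?_).symm
    obtain ⟨p, hp⟩ := (Finsupp.sum_eq_one_iff d).mp hdeg
    exact ⟨p, hp.symm⟩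

end Hyperplane

/-! ### The Hodge conjecture for hyperplanes (smooth hypersurfaces of degree `1`) -/

section DegreeOne

variable {n : ℕ} {Y : SchemeOver ℂ}

/-- **Lefschetz surjectivity in EVERY degree for a hyperplane.** For a smooth hypersurface
`Y ⊂ ℙⁿ⁺¹_ℂ` of degree `1` and every `p ≤ n`, some closed immersion `ι : Y ⟶ ℙⁿ⁺¹_ℂ` (the one
presenting `Y` as `V₊(F)`, `deg F = 1`) has `ι^* : H²ᵖ(ℙⁿ⁺¹(ℂ); ℂ) → H²ᵖ(Y(ℂ); ℂ)` onto: the duality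
half of Voisin II Thm. 1.23 (`surjective_map_of_isZero_singularHomology_compl_range`, `k = 2p`,
`j = 2n + 1 - 2p ≥ 1`) fed with the acyclicity of the complement of a hyperplane
(`isZero_singularHomology_compl_range_of_hyperplane`; `F = ℓ_a` with `a ≠ 0` since an irreducible form
is non-zero). [cite: VoisinHodgeII2003, §1.2.2 proof of Thm. 1.23, (1.7)–(1.9)] -/
theorem exists_surjective_map_of_isSmoothHypersurface_one (hY : IsSmoothHypersurface n 1 Y) {p : ℕ}
    (hp : p ≤ n) :
    ∃ ι : Y ⟶ projectiveSpace (n + 1) ℂ, Function.Surjective (complexBetti.map ι (2 * p)) := by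
  obtain ⟨F, hFhom, hFirr, -, ι, hι, hrange⟩ := hY.2
  haveI := hι
  refine ⟨ι, surjective_map_of_isZero_singularHomology_compl_range hY.1 ι (k := 2 * p)
    (j := 2 * n + 1 - 2 * p) (by omega) ?_⟩
  have hFa := linForm_coeff_eq_of_isHomogeneous_one (N := n + 1) hFhom
  have ha : (fun j ↦ MvPolynomial.coeff (Finsupp.single j 1) F) ≠ 0 := by
    intro h
    rw [h, linForm_zero] at hFa
    exact hFirr.ne_zero hFa.symm
  rw [← hFa] at hrange
  exact isZero_singularHomology_compl_range_of_hyperplane ι ha hrange (by omega)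

/-- **Every class on a hyperplane is algebraic**: for a smooth hypersurface `Y ⊂ ℙⁿ⁺¹_ℂ` of degree `1`
and every `p`, `algebraicClasses Y p = ⊤` — for `p ≤ n` every class is restricted from `ℙⁿ⁺¹`
(`exists_surjective_map_of_isSmoothHypersurface_one`) and restricted classes are algebraic
(`algebraicClasses_eq_top_of_surjective_map`); for `p > n`, `H²ᵖ(Y(ℂ); ℂ) = 0`
(`algebraicClasses_eq_top_of_lt`). Classically: `Y ≅ ℙⁿ` and `H²ᵖ(ℙⁿ, ℤ) = ℤ hᵖ` with `hᵖ` the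
class of a linear subspace. [cite: VoisinHodgeI2002, Thm. 7.14 and §11.1.2]
[cite: VoisinHodgeII2003, §1.2.3 Cor. 1.24] -/
theorem algebraicClasses_eq_top_of_isSmoothHypersurface_one (hY : IsSmoothHypersurface n 1 Y) (p : ℕ) :
    algebraicClasses Y p = ⊤ := by
  rcases le_or_gt p n with hp | hp
  · obtain ⟨ι, hι⟩ := exists_surjective_map_of_isSmoothHypersurface_one hY hp
    exact algebraicClasses_eq_top_of_surjective_map hY.1 ι hι
  · exact algebraicClasses_eq_top_of_lt hY.1 hp

/-- **The Hodge conjecture for hyperplanes, unconditionally**: every smooth hypersurface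
`Y ⊂ ℙⁿ⁺¹_ℂ` of degree `1` (so `Y ≅ ℙⁿ`), of any dimension `n`, satisfies `HodgeConjectureFor n Y` —
a Hodge model exists (`nonempty_hodgeModel_holds`: GAGA, de Rham, Hodge decomposition, all proved in
the tree) and in every codimension `p` ALL classes of `H²ᵖ(Y(ℂ); ℂ)`, in particular the rational
`(p,p)` ones, are algebraic (`algebraicClasses_eq_top_of_isSmoothHypersurface_one`).
[cite: VoisinHodgeI2002, Thm. 7.14, §11.1.2 and §11.3] [cite: Deligne2000, §1] -/
theorem hodgeConjectureFor_of_isSmoothHypersurface_one (hY : IsSmoothHypersurface n 1 Y) :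
    HodgeConjectureFor n Y := by
  refine ⟨nonempty_hodgeModel_holds hY.1, fun p c _ _ ↦ ?_⟩
  rw [algebraicClasses_eq_top_of_isSmoothHypersurface_one hY p]
  exact Submodule.mem_top

end DegreeOne

end Literature.AlgebraicGeometry.HodgeTheory

end
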